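import Literature.MathematicalPhysics.StatisticalMechanics.HcpHomogeneous

/-!
# Crux `StackingHinge` (stmt-AtomisticToContinuum-14993), line `Sketch`, stub `stub_hcpRootTransitive`

Re-rooting the relaxed hcp net `hcpStacking a h` at any of its sites `z` gives a LINEAR-isometric
image of the net: `(· - z) '' hcpStacking a h = A '' hcpStacking a h` for some linear isometry
equivalence `A` of `ℝ³` (the identity for sites of even layers, the half-turn about the third axis
for sites of odd layers).  A set-extensionality corollary of the in-tree homogeneity statement
`Literature.MathematicalPhysics.StatisticalMechanics.hcpStacking_homogeneous`
(`q ∈ hcp ↔ z + B q ∈ hcp`): for `y = q - z`, `y ∈ B '' hcp ↔ B.symm y ∈ hcp ↔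
z + B (B.symm y) ∈ hcp ↔ q ∈ hcp`.  No hypothesis on `a, h`.

This is the re-rooting step of the discrete-Liouville endgame of the line: the lead's composition
re-roots the local crystal `x + A_x (net)` at a neighbouring site.
-/

noncomputable section

namespace Summit.AtomisticToContinuum.Crystallization.Theorems.PricedHcpWindowsHcpRootTransitive

open Literature.MathematicalPhysics.StatisticalMechanics

/-- **Re-rooting an image of a set under a homogeneity isometry.**  If `B` is a linear isometry
equivalence with `q ∈ S ↔ z + B q ∈ S` for all `q`, then translating `S` by `-z` gives exactly
`B '' S`. [folklore] -/
theorem image_sub_eq_image_of_homogeneous {S : Set (EuclideanSpace ℝ (Fin 3))}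
    {z : EuclideanSpace ℝ (Fin 3)}
    (B : EuclideanSpace ℝ (Fin 3) ≃ₗᵢ[ℝ] EuclideanSpace ℝ (Fin 3))
    (hB : ∀ q, q ∈ S ↔ z + B q ∈ S) :
    (fun p : EuclideanSpace ℝ (Fin 3) => p - z) '' S = B '' S := by
  ext y
  constructor
  · rintro ⟨q, hq, rfl⟩
    refine ⟨B.symm (q - z), ?_, B.apply_symm_apply (q - z)⟩
    rw [hB, LinearIsometryEquiv.apply_symm_apply, add_sub_cancel]
    exact hq
  · rintro ⟨q, hq, rfl⟩
    exact ⟨z + B q, (hB q).1 hq, add_sub_cancel_left z (B q)⟩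

/-- **The relaxed hcp net is root-transitive by linear isometries**: for every site `z` of
`hcpStacking a h` there is a linear isometry equivalence `A` of `ℝ³` with
`(· - z) '' hcpStacking a h = A '' hcpStacking a h`, i.e. the net seen from any of its sites is a
rotated copy of the net seen from the origin.  Corollary of `hcpStacking_homogeneous` (identity on
even layers, half-turn on odd layers); no hypothesis on `a, h`. [folklore] -/
theorem stub_hcpRootTransitive : ∀ a h : ℝ, ∀ z ∈ Literature.MathematicalPhysics.StatisticalMechanics.hcpStacking a h, ∃ A : EuclideanSpace ℝ (Fin 3) ≃ₗᵢ[ℝ] EuclideanSpace ℝ (Fin 3), (fun p : EuclideanSpace ℝ (Fin 3) => p - z) '' Literature.MathematicalPhysics.StatisticalMechanics.hcpStacking a h = A '' Literature.MathematicalPhysics.StatisticalMechanics.hcpStacking a h := by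
  intro a h z hz
  obtain ⟨B, hB⟩ := hcpStacking_homogeneous a h hz
  exact ⟨B, image_sub_eq_image_of_homogeneous B hB⟩

end Summit.AtomisticToContinuum.Crystallization.Theorems.PricedHcpWindowsHcpRootTransitive

end
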